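import Mathlib.Analysis.Complex.Liouville
import Mathlib.Analysis.Complex.LocallyUniformLimit
import Mathlib.Analysis.Calculus.MeanValue
import Mathlib.Topology.UniformSpace.Ascoli
import Mathlib.Topology.UniformSpace.CompactConvergence
import HarnessLib

/-!
# Montel's theorem (normal families of holomorphic functions)

Trunk support (complex analysis), used by the proof of the Riemann mapping theorem
(`Literature/Analysis/Complex/RiemannMapping.lean`, feeding
`Literature/Probability/RandomPlanarGeometry/ConformalMap.lean: Literature.exists_conformalEquiv_ball`).

**Montel's theorem** (P. Montel 1907; textbook form: J. B. Conway, *Functions of one complex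
variable I*, 2nd ed., Ch. VII, Thm. 2.9): a family of holomorphic functions on an open set
`U ⊆ ℂ` is normal (every sequence has a subsequence converging uniformly on compact subsets of
`U`) iff it is locally bounded. We prove the direction used in practice ("locally bounded ⇒
normal"), in sequential form:

* `Complex.exists_ball_norm_sub_le_of_locally_bounded`: a locally bounded family of holomorphic
  functions is locally uniformly Lipschitz (Cauchy's estimate for the derivative on small discs plus
  the mean value inequality); this is the equicontinuity input, Conway VII.2.9 (proof) /
  Exercise VII.2.3.
* `Complex.exists_strictMono_tendstoLocallyUniformlyOn`: every locally bounded sequence of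
  holomorphic functions on an open `U` has a subsequence converging locally uniformly on `U`
  (Conway VII.2.9 with VII.1.23, the Arzelà–Ascoli theorem).
* `Complex.exists_strictMono_tendstoLocallyUniformlyOn_deriv`: the same, recording that the limit
  is holomorphic and that the derivatives converge locally uniformly as well (Conway VII.2.1).
* `Complex.exists_strictMono_tendstoLocallyUniformlyOn_of_norm_le`: the uniformly bounded case.

## Proof

We view the restrictions `F n|U` as elements of `C(U, ℂ)` with the compact-open topology (=
topology of uniform convergence on compacta, Mathlib's `ContinuousMap.compactConvergenceUniformSpace`)
and apply Mathlib's abstract Arzelà–Ascoli theorem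
`ArzelaAscoli.isCompact_closure_of_isClosedEmbedding` to the closed embedding
`C(U, ℂ) → (U →ᵤ[compacts] ℂ)`; since `U` is locally compact and σ-compact, `C(U, ℂ)` is first
countable, so compactness of the closure yields convergent subsequences
(`IsCompact.tendsto_subseq`), and convergence in `C(U, ℂ)` is locally uniform convergence
(`ContinuousMap.tendsto_iff_tendstoLocallyUniformly`).

Mathlib (this tree's version) has all these ingredients but no form of Montel's theorem (searched
`Montel`, `normal famil`, `locally bounded.*holomorphic`). As in
`Literature/Analysis/Complex/Hurwitz.lean`, the declarations are deliberately placed in the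
`Complex` namespace, next to Mathlib's `Complex.norm_deriv_le_of_forall_mem_sphere_norm_le` and
`TendstoLocallyUniformlyOn.differentiableOn` which they combine.

## References

* P. Montel, *Sur les suites infinies de fonctions*, Ann. Sci. Éc. Norm. Supér. (3) 24 (1907),
  233–334.
* J. B. Conway, *Functions of one complex variable I*, GTM 11, 2nd ed. (1978), Ch. VII, Def. 2.7,
  Lemma 2.8, Thm. 2.9, Thm. 1.23.
-/

noncomputable section

open Filter Metric Set Topology Function

namespace Complex

variable {U : Set ℂ} {ι : Type*}

/-- **Local Lipschitz bound for locally bounded holomorphic families** (the equicontinuity step in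
the proof of Montel's theorem, Conway VII.2.9; cf. Exercise VII.2.3): if the holomorphic functions
`F i` on an open set `U` are locally bounded (each point of `U` has a neighbourhood on which all
`‖F i‖` are bounded by one constant), then around each point of `U` there is a disc in `U` on which
all `F i` are Lipschitz with one constant. Proof: Cauchy's estimate `‖(F i)' z‖ ≤ M / R` on discs
of radius `R` inside the disc of radius `2R` where `‖F i‖ ≤ M`, then the mean value inequality on
the (convex) disc. [cite: Conway1978, Ch. VII Thm. 2.9 (proof)] -/
theorem exists_ball_norm_sub_le_of_locally_bounded (hU : IsOpen U) {F : ι → ℂ → ℂ}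
    (hF : ∀ i, DifferentiableOn ℂ (F i) U)
    (hb : ∀ a ∈ U, ∃ M : ℝ, ∃ r > 0, ∀ i, ∀ z ∈ ball a r ∩ U, ‖F i z‖ ≤ M) {a : ℂ} (ha : a ∈ U) :
    ∃ R > 0, ∃ L : ℝ, ball a R ⊆ U ∧
      ∀ i, ∀ z ∈ ball a R, ∀ w ∈ ball a R, ‖F i z - F i w‖ ≤ L * ‖z - w‖ := by
  obtain ⟨M, r₁, hr₁, hM⟩ := hb a ha
  obtain ⟨r₂, hr₂, hr₂U⟩ := nhds_basis_closedBall.mem_iff.1 (hU.mem_nhds ha)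
  obtain ⟨R, hR0, h2R₁, h2R₂⟩ : ∃ R : ℝ, 0 < R ∧ 2 * R < r₁ ∧ 2 * R ≤ r₂ :=
    ⟨min r₁ r₂ / 4, by positivity,
      by linarith [min_le_left r₁ r₂, lt_min hr₁ hr₂], by linarith [min_le_right r₁ r₂]⟩
  have hsubU : closedBall a (2 * R) ⊆ U := (closedBall_subset_closedBall h2R₂).trans hr₂U
  have hsub₁ : closedBall a (2 * R) ⊆ ball a r₁ := closedBall_subset_ball h2R₁
  have hM' : ∀ i, ∀ z ∈ closedBall a (2 * R), ‖F i z‖ ≤ M := fun i z hz ↦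
    hM i z ⟨hsub₁ hz, hsubU hz⟩
  have hballU : ball a R ⊆ U :=
    ball_subset_closedBall.trans ((closedBall_subset_closedBall (by linarith)).trans hsubU)
  -- Cauchy's estimate on `ball z R ⊆ closedBall a (2R)`
  have hderiv : ∀ i, ∀ z ∈ ball a R, ‖deriv (F i) z‖ ≤ M / R := by
    intro i z hz
    have hzR : closedBall z R ⊆ closedBall a (2 * R) := by
      intro w hw
      rw [mem_closedBall] at hw ⊢
      have hz' := mem_ball.1 hz
      linarith [dist_triangle w z a]
    exact norm_deriv_le_of_forall_mem_sphere_norm_le hR0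
      ((hF i).diffContOnCl_ball (hzR.trans hsubU))
      fun w hw ↦ hM' i w (hzR (sphere_subset_closedBall hw))
  refine ⟨R, hR0, M / R, hballU, fun i z hz w hw ↦ ?_⟩
  have hdiff : ∀ x ∈ ball a R, DifferentiableAt ℂ (F i) x := fun x hx ↦
    (hF i).differentiableAt (hU.mem_nhds (hballU hx))
  exact (convex_ball a R).norm_image_sub_le_of_norm_deriv_le hdiff (hderiv i) hw hz

/-- **Montel's theorem** (Conway VII.2.9, sequential form of "locally bounded ⇒ normal"). Let
`U ⊆ ℂ` be open and let `F : ℕ → ℂ → ℂ` be holomorphic on `U` and locally bounded on `U` (every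
point of `U` has a neighbourhood on which all `‖F n‖` are bounded by one constant). Then some
subsequence `F ∘ φ` converges locally uniformly on `U` (equivalently, uniformly on every compact
subset of `U`). Proof: Arzelà–Ascoli (Conway VII.1.23, here Mathlib's
`ArzelaAscoli.isCompact_closure_of_isClosedEmbedding` in `C(U, ℂ)`) using the equicontinuity bound
`Complex.exists_ball_norm_sub_le_of_locally_bounded`. [cite: Conway1978, Ch. VII Thm. 2.9] -/
theorem exists_strictMono_tendstoLocallyUniformlyOn (hU : IsOpen U) {F : ℕ → ℂ → ℂ}
    (hF : ∀ n, DifferentiableOn ℂ (F n) U)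
    (hb : ∀ a ∈ U, ∃ M : ℝ, ∃ r > 0, ∀ n, ∀ z ∈ ball a r ∩ U, ‖F n z‖ ≤ M) :
    ∃ f : ℂ → ℂ, ∃ φ : ℕ → ℕ, StrictMono φ ∧
      TendstoLocallyUniformlyOn (fun n ↦ F (φ n)) f atTop U := by
  classical
  haveI : LocallyCompactSpace U := hU.locallyCompactSpace
  -- the restrictions to `U`, as elements of `C(U, ℂ)`
  obtain ⟨G, hG⟩ : ∃ G : ℕ → C(U, ℂ), ∀ n, ∀ x : U, G n x = F n x :=
    ⟨fun n ↦ ⟨U.restrict (F n), (hF n).continuousOn.restrict⟩, fun _ _ ↦ rfl⟩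
  -- `C(U, ℂ) → (U →ᵤ[compacts] ℂ)` is a closed embedding (`U` is locally compact)
  have hce : IsClosedEmbedding
      (UniformOnFun.ofFun {K : Set U | IsCompact K} ∘ fun f : C(U, ℂ) ↦ (⇑f : U → ℂ)) := by
    refine ⟨ContinuousMap.isUniformEmbedding_toUniformOnFunIsCompact.isEmbedding, ?_⟩
    change IsClosed (range (ContinuousMap.toUniformOnFunIsCompact : C(U, ℂ) → _))
    rw [ContinuousMap.range_toUniformOnFunIsCompact]
    exact UniformOnFun.isClosed_setOf_continuous CompactlyCoherentSpace.isCoherentWith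
  -- the family `{G n}` is equicontinuous
  have heq : Equicontinuous
      ((fun f : C(U, ℂ) ↦ (⇑f : U → ℂ)) ∘ ((↑) : range G → C(U, ℂ))) := by
    intro x₀
    rw [Metric.equicontinuousAt_iff]
    intro ε hε
    obtain ⟨R, hR, L, -, hL⟩ := exists_ball_norm_sub_le_of_locally_bounded hU hF hb x₀.2
    refine ⟨min R (ε / (|L| + 1)), lt_min hR (by positivity), ?_⟩
    rintro x hx ⟨_, n, rfl⟩
    change dist (G n x₀) (G n x) < ε
    rw [hG, hG, dist_eq_norm]
    have hxR : (x : ℂ) ∈ ball (x₀ : ℂ) R :=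
      mem_ball.2 (lt_of_lt_of_le hx (min_le_left _ _))
    have hxε : ‖(x₀ : ℂ) - x‖ < ε / (|L| + 1) := by
      rw [← dist_eq_norm, dist_comm]
      exact lt_of_lt_of_le hx (min_le_right _ _)
    have hpos : 0 < |L| + 1 := by positivity
    calc ‖F n x₀ - F n x‖ ≤ L * ‖(x₀ : ℂ) - x‖ := hL n x₀ (mem_ball_self hR) x hxR
      _ ≤ (|L| + 1) * ‖(x₀ : ℂ) - x‖ := by gcongr; linarith [le_abs_self L]
      _ < (|L| + 1) * (ε / (|L| + 1)) := by gcongr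
      _ = ε := by field_simp
  -- pointwise boundedness
  have hpt : ∀ K ∈ {K : Set U | IsCompact K}, ∀ x ∈ K, ∃ Q : Set ℂ, IsCompact Q ∧
      ∀ i ∈ range G, (fun f : C(U, ℂ) ↦ (⇑f : U → ℂ)) i x ∈ Q := by
    intro K _ x _
    obtain ⟨M, r, hr, hM⟩ := hb x x.2
    refine ⟨closedBall 0 M, isCompact_closedBall _ _, ?_⟩
    rintro _ ⟨n, rfl⟩
    change G n x ∈ closedBall (0 : ℂ) M
    rw [hG, mem_closedBall_zero_iff]
    exact hM n x ⟨mem_ball_self hr, x.2⟩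
  have hcpt : IsCompact (closure (range G)) :=
    ArzelaAscoli.isCompact_closure_of_isClosedEmbedding (F := fun f : C(U, ℂ) ↦ (⇑f : U → ℂ))
      (fun K hK ↦ hK) hce (fun K _ ↦ heq.equicontinuousOn K) hpt
  obtain ⟨g, -, φ, hφ, hlim⟩ :=
    hcpt.tendsto_subseq (x := G) fun n ↦ subset_closure (mem_range_self n)
  rw [ContinuousMap.tendsto_iff_tendstoLocallyUniformly] at hlim
  refine ⟨fun z ↦ if hz : z ∈ U then g ⟨z, hz⟩ else 0, φ, hφ, ?_⟩
  rw [tendstoLocallyUniformlyOn_iff_tendstoLocallyUniformly_comp_coe]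
  have h1 : (fun i (x : U) ↦ F (φ i) (x : ℂ)) = fun i a ↦ (G ∘ φ) i a := by
    funext i x
    simp [hG]
  have h2 : ((fun z ↦ if hz : z ∈ U then g ⟨z, hz⟩ else 0) ∘ ((↑) : U → ℂ)) = ⇑g := by
    funext x
    simp [x.2]
  rw [h1, h2]
  exact hlim

/-- **Montel's theorem** with the analytic consequences recorded (Conway VII.2.9 with VII.2.1):
under the hypotheses of `Complex.exists_strictMono_tendstoLocallyUniformlyOn`, the locally uniform
limit `f` of the subsequence is holomorphic on `U` and the derivatives converge locally uniformly
to `f'` (Weierstrass; Mathlib's `TendstoLocallyUniformlyOn.differentiableOn` / `.deriv`). [cite: Conway1978, Ch. VII Thm. 2.9 and Thm. 2.1] -/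
theorem exists_strictMono_tendstoLocallyUniformlyOn_deriv (hU : IsOpen U) {F : ℕ → ℂ → ℂ}
    (hF : ∀ n, DifferentiableOn ℂ (F n) U)
    (hb : ∀ a ∈ U, ∃ M : ℝ, ∃ r > 0, ∀ n, ∀ z ∈ ball a r ∩ U, ‖F n z‖ ≤ M) :
    ∃ f : ℂ → ℂ, ∃ φ : ℕ → ℕ, StrictMono φ ∧ DifferentiableOn ℂ f U ∧
      TendstoLocallyUniformlyOn (fun n ↦ F (φ n)) f atTop U ∧
      TendstoLocallyUniformlyOn (fun n ↦ deriv (F (φ n))) (deriv f) atTop U := by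
  obtain ⟨f, φ, hφ, hlim⟩ := exists_strictMono_tendstoLocallyUniformlyOn hU hF hb
  have hF' : ∀ᶠ n in atTop, DifferentiableOn ℂ (F (φ n)) U := Eventually.of_forall fun n ↦ hF _
  exact ⟨f, φ, hφ, hlim.differentiableOn hF' hU, hlim, hlim.deriv hF' hU⟩

/-- **Montel's theorem**, uniformly bounded case (Conway VII.2.9): a sequence of holomorphic
functions on an open set `U`, bounded by one constant on `U`, has a locally uniformly convergent
subsequence, whose limit is holomorphic with locally uniformly convergent derivatives. This is the
form used in the proof of the Riemann mapping theorem (Conway VII.4.3). [cite: Conway1978, Ch. VII Thm. 2.9] -/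
theorem exists_strictMono_tendstoLocallyUniformlyOn_of_norm_le (hU : IsOpen U) {F : ℕ → ℂ → ℂ}
    {M : ℝ} (hF : ∀ n, DifferentiableOn ℂ (F n) U) (hM : ∀ n, ∀ z ∈ U, ‖F n z‖ ≤ M) :
    ∃ f : ℂ → ℂ, ∃ φ : ℕ → ℕ, StrictMono φ ∧ DifferentiableOn ℂ f U ∧
      TendstoLocallyUniformlyOn (fun n ↦ F (φ n)) f atTop U ∧
      TendstoLocallyUniformlyOn (fun n ↦ deriv (F (φ n))) (deriv f) atTop U :=
  exists_strictMono_tendstoLocallyUniformlyOn_deriv hU hF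
    fun _ _ ↦ ⟨M, 1, one_pos, fun n _ hz ↦ hM n _ hz.2⟩

end Complex

end
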